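/-
Copyright (c) 2026. Released under Apache 2.0 license.
-/
import Summits.RiemannHypothesis.RiemannHypothesis.Theorems.SemilocalCert552Data
import Literature.NumberTheory.LFunctions.WeilBlockRows
import HarnessLib

/-!
# Semi-local threshold `a*({2})`, lower rung `b = 69/125`: dominance rows 4–7 of the parity-0 block

Cell `rh-explicit` (HOME `run/shared/lean/pub/rh-explicit/`), seat cc-s2-2, block C⁺/B1 (lead R3-4 (3) / R3-9 (1)).
The one-prime Stage-C certificate `weilCert3S552 : WeilCert3` (`WeilFirstPrimeCertificateZ.lean`) at half-length
`a₀ = b = 69/125 = 0.552` RE-USES verbatim the level `wL`, the cut-off `T = 50`, the 145 integer-checked cells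
(`prec = 72`, `j = 5`) and the Legendre blocks `C`, `D` (`N = 99`, `nb = 50`) of the tree's base-rung certificate
`weilCert3C` (`WeilFirstPrimeCertificateDataC.lean`, `b = 563/1024`); new are the rescaled moment table (`pnu = 61`,
checked against `weilCert3C`'s kernel-verified table by `WeilCert3.checkNuAt_of_scaled`), the dyadic PSD factors
`U` of both parity blocks, and `κ`.  Generated by exact rational arithmetic mirroring the checker
(`λ_min(S'_even) ≈ 3.72·10⁻⁸`, `λ_min(S'_odd) ≈ 5.19·10⁻⁶` in floating point; exact dominance slack
`1.86·10⁻⁸` / `2.59·10⁻⁶`).  Nothing about the data is trusted: the bridge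
`le_weilSemilocalThreshold_two_of_check_of_le` (`SemilocalThresholdCertificateBridge.lean`) consumes only the
kernel-evaluated Boolean `weilCert3S552.check = true`.  With the same cells the odd block stops being PSD at
`a₀ ≈ 0.5523` (flat minorant beyond `T = 50`); wider windows need a longer cell chain.
`R = S'_0(κ) − UᵀU` row by row (`WeilCert.checkDomRow`, `WeilBlockRows.lean`), each by `decide +kernel` in its own
declaration; assembled in `SemilocalCert552Block0.lean` by `WeilCert.checkBlockK_of_rows`. Pure proof file.
-/

set_option linter.dupNamespace false  -- the mandated namespace repeats `RiemannHypothesis`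

noncomputable section

open Literature.NumberTheory.LFunctions

namespace Summit.RiemannHypothesis.RiemannHypothesis.Theorems.SemilocalCert552

set_option maxHeartbeats 0 in
/-- Kernel check of the dominance of row 4 of `R = S' − UᵀU`, parity 0, certificate `weilCert3S552`. [folklore] -/
theorem checkDomRow0_4_cert552 : weilCert3S552.base.checkDomRow cert552NuData (372225048789690954189355223128560212429/340282366920938463463374607431768211456 : ℚ) 0 4 = true := by
  decide +kernel

set_option maxHeartbeats 0 in
/-- Kernel check of the dominance of row 5 of `R = S' − UᵀU`, parity 0, certificate `weilCert3S552`. [folklore] -/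
theorem checkDomRow0_5_cert552 : weilCert3S552.base.checkDomRow cert552NuData (372225048789690954189355223128560212429/340282366920938463463374607431768211456 : ℚ) 0 5 = true := by
  decide +kernel

set_option maxHeartbeats 0 in
/-- Kernel check of the dominance of row 6 of `R = S' − UᵀU`, parity 0, certificate `weilCert3S552`. [folklore] -/
theorem checkDomRow0_6_cert552 : weilCert3S552.base.checkDomRow cert552NuData (372225048789690954189355223128560212429/340282366920938463463374607431768211456 : ℚ) 0 6 = true := by
  decide +kernel

set_option maxHeartbeats 0 in
/-- Kernel check of the dominance of row 7 of `R = S' − UᵀU`, parity 0, certificate `weilCert3S552`. [folklore] -/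
theorem checkDomRow0_7_cert552 : weilCert3S552.base.checkDomRow cert552NuData (372225048789690954189355223128560212429/340282366920938463463374607431768211456 : ℚ) 0 7 = true := by
  decide +kernel

end Summit.RiemannHypothesis.RiemannHypothesis.Theorems.SemilocalCert552

end
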